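import Literature.NumberTheory.EllipticCurves.YanZhu2026.GreenbergDivisibilityProofs
import Literature.NumberTheory.EllipticCurves.IwasawaAlgebraStructureProofs
import HarnessLib

/-!
# Divisibility in `Λ = ℤ_p⟦T⟧` is detected in `𝒪_{ℂ_p}⟦T⟧` along a structure map `J : ℤ_p → 𝒪_{ℂ_p}`

Route-independent `Theorems` file of the cell `bsd-wall`, seat `bsd-wall-sbc-p2` (prover, crux K2R‴ =
stmt-BirchSwinnertonDyer-20213 `SignedLowerDescentFromCommonFrame`, stub (S3) `stub_transferDescent`).

The last step of the two-variable signed descent (BSTW arXiv:2409.01350v2 §2.3, proof of Thm. (KoMC_r))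
lands a divisibility `L₁L₂L₃L₄ ∣ g₁g₂g₃g₄` between the IMAGES of cyclotomic series of `Λ = ℤ_p⟦T⟧`
(Pollack's `L^±`, Kobayashi's characteristic power series) in the receptacle `𝒪_{ℂ_p}⟦T⟧` of the
Greenberg side (typer memo `TYPER-MEMO-2VAR-SIGNED-PACKAGE-v1.md` §5: «+ 𝒪⟦T⟧ → ℤ_p⟦T⟧ divisibility
descent», the one algebraic step the package binder
`BurungaleSkinnerTianWan2024.props118_27_519_exists_signedTwoVariablePackage_supersingular_PRE` leaves to
the consumer). The consumer's currency (`KobayashiLowerDivisibility`) is divisibility in `Λ` itself. This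
file proves that nothing is lost: for `a, b ∈ ℤ_p⟦T⟧` and any ring map `J : ℤ_p → 𝒪_{ℂ_p}` compatible
with `ℤ_p ⊂ ℚ_p ⊂ ℂ_p`, `a.map J ∣ b.map J` in `𝒪_{ℂ_p}⟦T⟧` implies `a ∣ b` in `ℤ_p⟦T⟧`
(`iwasawaAlgebra_dvd_of_map_dvd_map_padicComplexInt`). `𝒪_{ℂ_p}` is neither noetherian nor finite
over `ℤ_p`, so the tree's faithful-flatness descent (`…PlusMCEtaKPrincipalIdealBaseChange`,
finite free extensions) does not apply; the proof is Weierstrass division instead: write `a = p^m · a'`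
with `a' ≢ 0 (mod p)` (`exists_eq_C_pow_mul_and_map_residue_ne_zero`); the `p^m` descends
coefficientwise through the norm (`J` is isometric); `a'` is a Weierstrass divisor of `ℤ_p⟦T⟧` at `𝔪`
AND its image one of `𝒪_{ℂ_p}⟦T⟧` at `(J p)` (same reduced order; `𝒪_{ℂ_p}` is `(J p)`-adically separated,
`isAdicComplete_padicComplexInt_span_singleton`), so the Weierstrass remainder of `b/p^m` by `a'` computed
over `ℤ_p` (Mathlib `PowerSeries.exists_isWeierstrassDivision`) must vanish after `J` by uniqueness of
Weierstrass division over `𝒪_{ℂ_p}` (Mathlib `IsWeierstrassDivisorAt.eq_of_mul_add_eq_mul_add`), hence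
vanishes. References: Washington, *Cyclotomic Fields*, Prop. 7.2 / Thm. 7.3 (Weierstrass division and
preparation); Bourbaki AC VII §3 no. 8 Prop. 5.
-/

set_option autoImplicit false

noncomputable section

open scoped Classical

open PowerSeries Literature.NumberTheory.EllipticCurves Literature.RingTheory.PowerSeries

namespace Summit.BirchSwinnertonDyer.BirchSwinnertonDyer.Theorems.SignedBaseChangeK2RDivisibilityDescent

variable {p : ℕ} [Fact p.Prime]

/-- A structure map `J : ℤ_p → 𝒪_{ℂ_p}` compatible with `ℤ_p ⊂ ℚ_p ⊂ ℂ_p` is isometric.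
[cite: Washington1997, §7.1 (the absolute value on ℂ_p extends that of ℚ_p)] -/
theorem norm_structureMap {J : ℤ_[p] →+* PadicComplexInt p}
    (hJ : ∀ x : ℤ_[p], ((J x : PadicComplexInt p) : ℂ_[p]) = ((x : ℚ_[p]) : ℂ_[p])) (x : ℤ_[p]) :
    ‖((J x : PadicComplexInt p) : ℂ_[p])‖ = ‖x‖ := by
  rw [hJ, PadicComplex.norm_extends' p, PadicInt.padic_norm_e_of_padicInt]

/-- `‖J p‖ < 1`. [cite: Washington1997, §7.1] -/
theorem norm_structureMap_prime_lt_one {J : ℤ_[p] →+* PadicComplexInt p}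
    (hJ : ∀ x : ℤ_[p], ((J x : PadicComplexInt p) : ℂ_[p]) = ((x : ℚ_[p]) : ℂ_[p])) :
    ‖((J (p : ℤ_[p]) : PadicComplexInt p) : ℂ_[p])‖ < 1 := by
  rw [norm_structureMap hJ, PadicInt.norm_p]
  have hp : (1 : ℝ) < p := by exact_mod_cast (Fact.out : p.Prime).one_lt
  exact inv_lt_one_of_one_lt₀ hp

/-- Coefficientwise `p`-power divisibility descends along `J`: if every coefficient of `b.map J` is
divisible by `(J p)^m` in `𝒪_{ℂ_p}`, then `C (p^m) ∣ b` in `ℤ_p⟦T⟧` (norms are preserved by `J`, and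
`‖x‖ ≤ p^{-m} ⟺ p^m ∣ x` in `ℤ_p`). [cite: Washington1997, Lemma 13.7 / proof of Thm. 7.3 (the p-content of a power series)] -/
theorem C_pow_dvd_of_forall_coeff_map_dvd {J : ℤ_[p] →+* PadicComplexInt p}
    (hJ : ∀ x : ℤ_[p], ((J x : PadicComplexInt p) : ℂ_[p]) = ((x : ℚ_[p]) : ℂ_[p]))
    {b : IwasawaAlgebra p} {m : ℕ}
    (h : ∀ k : ℕ, (J (p : ℤ_[p])) ^ m ∣ PowerSeries.coeff k (PowerSeries.map J b)) :
    PowerSeries.C ((p : ℤ_[p]) ^ m) ∣ b := by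
  have hk : ∀ k : ℕ, (p : ℤ_[p]) ^ m ∣ PowerSeries.coeff k b := by
    intro k
    obtain ⟨c, hc⟩ := h k
    rw [PowerSeries.coeff_map] at hc
    have hnorm : ‖PowerSeries.coeff k b‖ ≤ (p : ℝ) ^ (-(m : ℤ)) := by
      rw [← norm_structureMap hJ, hc]
      push_cast
      rw [norm_mul, norm_pow, norm_structureMap hJ, PadicInt.norm_p, zpow_neg, zpow_natCast, ← inv_pow]
      exact mul_le_of_le_one_right (pow_nonneg (inv_nonneg.mpr (Nat.cast_nonneg p)) m)
        (norm_coe_padicComplexInt_le_one c)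
    exact Ideal.mem_span_singleton.mp ((PadicInt.norm_le_pow_iff_mem_span_pow _ m).mp hnorm)
  refine ⟨PowerSeries.mk fun k ↦ (hk k).choose, ?_⟩
  ext k
  rw [PowerSeries.coeff_C_mul, PowerSeries.coeff_mk]
  exact (hk k).choose_spec

/-- **Divisibility in `ℤ_p⟦T⟧` is detected in `𝒪_{ℂ_p}⟦T⟧`**: for a structure map `J : ℤ_p → 𝒪_{ℂ_p}`
compatible with `ℤ_p ⊂ ℚ_p ⊂ ℂ_p` and `a, b ∈ Λ = ℤ_p⟦T⟧`, if `a.map J ∣ b.map J` in `𝒪_{ℂ_p}⟦T⟧` then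
`a ∣ b` in `Λ`. Proof: `a = p^m · a'`, `a' ≢ 0 (mod p)`; the `p^m` descends through the norm; then
Weierstrass-divide `b / p^m` by `a'` over `ℤ_p` and compare with the exact division over `𝒪_{ℂ_p}` — the
image of `a'` is a Weierstrass divisor at `(J p)` of the same reduced order, `𝒪_{ℂ_p}` is `(J p)`-adically
separated, so the remainder vanishes by uniqueness.
[cite: Washington1997, Prop. 7.2 and Thm. 7.3 (Weierstrass division / preparation in 𝒪⟦T⟧)] -/
theorem iwasawaAlgebra_dvd_of_map_dvd_map_padicComplexInt {J : ℤ_[p] →+* PadicComplexInt p}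
    (hJ : ∀ x : ℤ_[p], ((J x : PadicComplexInt p) : ℂ_[p]) = ((x : ℚ_[p]) : ℂ_[p]))
    {a b : IwasawaAlgebra p} (h : PowerSeries.map J a ∣ PowerSeries.map J b) : a ∣ b := by
  have hinj : Function.Injective J := Literature.NumberTheory.EllipticCurves.structureMap_injective hJ
  have hmapinj : Function.Injective
      (PowerSeries.map J : IwasawaAlgebra p → PowerSeries (PadicComplexInt p)) :=
    PowerSeries.map_injective J hinj
  by_cases ha : a = 0
  · subst ha
    rw [map_zero] at h
    obtain ⟨c, hc⟩ := h
    rw [zero_mul] at hc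
    have hb : b = 0 := hmapinj (by rw [hc, map_zero])
    rw [hb]
  -- `a = p^m · a'` with `a' ≢ 0 (mod p)`
  obtain ⟨m, a', rfl, ha'⟩ := IwasawaAlgebra.exists_eq_C_pow_mul_and_map_residue_ne_zero p ha
  -- the reduced order `n` of `a'`, its unit coefficient and its lower coefficients
  set n : ℕ := (a'.map (IsLocalRing.residue ℤ_[p])).order.toNat with hn_def
  have horder : (a'.map (IsLocalRing.residue ℤ_[p])).order = n := by
    rw [hn_def, ENat.coe_toNat]
    exact (PowerSeries.order_finite_iff_ne_zero.mpr ha').ne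
  have hunit : IsUnit (PowerSeries.coeff n a') := by
    have h1 := PowerSeries.coeff_order ha'
    rw [← hn_def, PowerSeries.coeff_map] at h1
    by_contra hnu
    exact h1 ((IsLocalRing.residue_eq_zero_iff _).mpr ((IsLocalRing.mem_maximalIdeal _).mpr hnu))
  have hlow : ∀ j < n, (p : ℤ_[p]) ∣ PowerSeries.coeff j a' := by
    intro j hj
    have h1 : PowerSeries.coeff j (a'.map (IsLocalRing.residue ℤ_[p])) = 0 :=
      PowerSeries.coeff_of_lt_order j (by rw [horder]; exact_mod_cast hj)
    rw [PowerSeries.coeff_map, IsLocalRing.residue_eq_zero_iff, PadicInt.maximalIdeal_eq_span_p,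
      Ideal.mem_span_singleton] at h1
    exact h1
  -- Step 1: `p^m` descends coefficientwise, `b = p^m · b₁`
  obtain ⟨c, hc⟩ := h
  have hc' : PowerSeries.map J b =
      PowerSeries.C ((J (p : ℤ_[p])) ^ m) * (PowerSeries.map J a' * c) := by
    rw [hc, map_mul, PowerSeries.map_C, map_pow]; ring
  obtain ⟨b₁, rfl⟩ : PowerSeries.C ((p : ℤ_[p]) ^ m) ∣ b := by
    refine C_pow_dvd_of_forall_coeff_map_dvd hJ fun k ↦ ?_
    rw [hc', PowerSeries.coeff_C_mul]
    exact Dvd.intro _ rfl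
  -- cancel `p^m` in the domain `𝒪_{ℂ_p}⟦T⟧`: `b₁.map J = a'.map J * c`
  refine mul_dvd_mul_left _ ?_
  have hJp : (J (p : ℤ_[p])) ^ m ≠ 0 :=
    pow_ne_zero _ fun h0 ↦ (Fact.out : p.Prime).ne_zero (by
      have := hinj (by rw [h0, map_zero] : J (p : ℤ_[p]) = J 0)
      exact_mod_cast this)
  have hCne : PowerSeries.C ((J (p : ℤ_[p])) ^ m) ≠ 0 := fun h0 ↦
    hJp (by simpa using congrArg (PowerSeries.coeff 0) h0)
  have hb₁ : PowerSeries.map J b₁ = PowerSeries.map J a' * c := by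
    apply mul_left_cancel₀ hCne
    rw [← hc', map_mul, PowerSeries.map_C]
    simp only [map_pow]
  -- Step 2: Weierstrass division of `b₁` by `a'` over the complete local ring `ℤ_p`
  obtain ⟨q, r, hqr⟩ := PowerSeries.exists_isWeierstrassDivision b₁ ha'
  have hdeg : r.degree < n := by
    have h1 := hqr.degree_lt
    have h2 : (PowerSeries.map (Ideal.Quotient.mk (IsLocalRing.maximalIdeal ℤ_[p])) a').order.toNat = n := by
      change (PowerSeries.map (IsLocalRing.residue ℤ_[p]) a').order.toNat = n
      rw [horder, ENat.toNat_coe]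
    rwa [h2] at h1
  -- Step 3: the image of `a'` is a Weierstrass divisor of `𝒪_{ℂ_p}⟦T⟧` at `(J p)`, of reduced order `n`
  set I : Ideal (PadicComplexInt p) := Ideal.span {J (p : ℤ_[p])} with hI_def
  have hϖ : ‖((J (p : ℤ_[p]) : PadicComplexInt p) : ℂ_[p])‖ < 1 := norm_structureMap_prime_lt_one hJ
  haveI : IsAdicComplete I (PadicComplexInt p) := isAdicComplete_padicComplexInt_span_singleton hϖ
  have hI : I ≠ ⊤ := span_singleton_padicComplexInt_ne_top hϖ
  have hlt' : ∀ j < n, PowerSeries.coeff j (PowerSeries.map J a') ∈ I := fun j hj ↦ by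
    rw [PowerSeries.coeff_map]
    exact Ideal.mem_span_singleton.mpr (map_dvd J (hlow j hj))
  have hunit' : IsUnit (PowerSeries.coeff n (PowerSeries.map J a')) := by
    rw [PowerSeries.coeff_map]; exact hunit.map J
  have HW : (PowerSeries.map J a').IsWeierstrassDivisorAt I :=
    isWeierstrassDivisorAt_of_coeff_mem_of_isUnit hI hlt' hunit'
  have horder' : ((PowerSeries.map J a').map (Ideal.Quotient.mk I)).order.toNat = n := by
    rw [order_map_mk_eq_of_coeff_mem hlt' (fun hmem ↦ hI (Ideal.eq_top_of_isUnit_mem I hmem hunit')),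
      ENat.toNat_coe]
  -- Step 4: compare the two divisions in `𝒪_{ℂ_p}⟦T⟧`; by uniqueness the remainder `r` vanishes after `J`
  have heq : PowerSeries.map J a' * PowerSeries.map J q + ((r.map J : Polynomial (PadicComplexInt p)) :
        PowerSeries (PadicComplexInt p)) =
      PowerSeries.map J a' * c + ((0 : Polynomial (PadicComplexInt p)) : PowerSeries (PadicComplexInt p)) := by
    rw [Polynomial.polynomial_map_coe, ← map_mul, ← map_add, ← hqr.eq_mul_add, hb₁, Polynomial.coe_zero,
      add_zero]
  have hr1 : (r.map J).degree < ((PowerSeries.map J a').map (Ideal.Quotient.mk I)).order.toNat := by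
    rw [horder', Polynomial.degree_map_eq_of_injective hinj]
    exact hdeg
  have hr0 : (0 : Polynomial (PadicComplexInt p)).degree <
      ((PowerSeries.map J a').map (Ideal.Quotient.mk I)).order.toNat := by
    rw [horder', Polynomial.degree_zero]
    exact WithBot.bot_lt_coe n
  obtain ⟨-, hr⟩ := HW.eq_of_mul_add_eq_mul_add hr1 hr0 heq
  have hr' : r = 0 := Polynomial.map_injective J hinj (by rw [hr, Polynomial.map_zero])
  refine ⟨q, ?_⟩
  rw [hqr.eq_mul_add, hr', Polynomial.coe_zero, add_zero]

end Summit.BirchSwinnertonDyer.BirchSwinnertonDyer.Theorems.SignedBaseChangeK2RDivisibilityDescent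

end
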